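import Mathlib

/-!
# The S-line lemma (solo-informed notes, Part II §7.11 (16.5)(b)(ii))

At a prime `v | p` the local condition of the first-order reciprocity law cuts the
two-dimensional space `U/p` of unit classes by ONE linear functional `α_v`; when `α_v ≠ 0`
its kernel — the "S-line" `L_v` — is a line, i.e. one of the `p + 1` points of `ℙ(U/p)`.
This file records the linear algebra: on a space of dimension `2`, the kernel of a non-zero
functional has dimension exactly `1`, and more generally on dimension `n + 1` it has dimension `n`.
-/

namespace Summit.Langlands.Langlands.Theorems

open Module

/-- On a finite-dimensional space, a non-zero linear functional has range of dimension `1`. -/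
theorem soloInformed_finrank_range_eq_one_of_ne_zero {K V : Type*} [Field K] [AddCommGroup V]
    [Module K V] [FiniteDimensional K V] (α : V →ₗ[K] K) (hα : α ≠ 0) :
    finrank K (LinearMap.range α) = 1 := by
  have h1 : finrank K (LinearMap.range α) ≤ 1 := by
    have := Submodule.finrank_le (LinearMap.range α)
    simpa using this
  have h0 : finrank K (LinearMap.range α) ≠ 0 := by
    intro h
    have hbot : LinearMap.range α = ⊥ := Submodule.finrank_eq_zero.mp h
    exact hα (LinearMap.range_eq_bot.mp hbot)
  omega

/-- The S-line lemma: on a space of dimension `n + 1`, the kernel of a non-zero linear functional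
has dimension `n`. -/
theorem soloInformed_finrank_ker_of_ne_zero {K V : Type*} [Field K] [AddCommGroup V]
    [Module K V] [FiniteDimensional K V] {n : ℕ} (hV : finrank K V = n + 1)
    (α : V →ₗ[K] K) (hα : α ≠ 0) :
    finrank K (LinearMap.ker α) = n := by
  have hr := soloInformed_finrank_range_eq_one_of_ne_zero α hα
  have := LinearMap.finrank_range_add_finrank_ker α
  omega

/-- The case used in §7.11 (16.5): `dim U/p = 2`, so the S-line `ker α_v` is a line. -/
theorem soloInformed_sLine_is_line {K V : Type*} [Field K] [AddCommGroup V]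
    [Module K V] [FiniteDimensional K V] (hV : finrank K V = 2)
    (α : V →ₗ[K] K) (hα : α ≠ 0) :
    finrank K (LinearMap.ker α) = 1 :=
  soloInformed_finrank_ker_of_ne_zero (n := 1) hV α hα

/-- Conversely a functional vanishing on the whole `2`-dimensional space is zero, so an S-line that is
"all of `ℙ¹`" (the two exceptional cases of the census) means `α_v = 0`. -/
theorem soloInformed_functional_eq_zero_of_ker_eq_top {K V : Type*} [Field K] [AddCommGroup V]
    [Module K V] (α : V →ₗ[K] K) (h : LinearMap.ker α = ⊤) : α = 0 :=
  LinearMap.ker_eq_top.mp h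

end Summit.Langlands.Langlands.Theorems
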